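import Summits.QuantumAdvantage.QuantumAdvantage.Theorems.RankDialH3
import HarnessLib

/-!
# RankDial (I1) — §22 functions of `d` linear forms cost `p^d` characters (`norm_sum_mul_prod_indC_le`, `norm_sum_mul_comp_le`)

TARGET BY NAME (cell decomp-qadv, RESIDUAL MODE): item stmt-QuantumAdvantage-23109
`Summit.QuantumAdvantage.QuantumAdvantage.Theses.OddPrimeWalk.ManyReadersSqrtOdd`, through rung R5 = `AdviceFreeQNC0.WalkHardFLinSel p`.
This file SUPPORTS the item (`--supports`); it does not close it.  Declaration bodies are byte-identical to the cell node
«SpanDial» (decomp-qadv lens-1, generation 26, part I; node file RankDialI.lean, whose §1–§21 are node «MixedDial» =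
parts G1–G2, H1–H3), cut into ≤ 400-line parts
I1 (§22 indicator closure and the `p^d` composition bound) → I2 (§23 the wide-rank grade `WRankLE`, span fibre and window theorems) → I3 (§24 pieces `WindowSpanLinSel` PROVED `p ≠ 3`, residual `WindowSpreadLinSel`, `span_dial`);
see the node file for the mechanism summary.
-/

set_option linter.dupNamespace false
set_option autoImplicit false

noncomputable section
open Classical

namespace Summit.QuantumAdvantage.QuantumAdvantage.Theorems.RankDial

open Finset
open Summit.QuantumAdvantage.AdviceFreeQNC0
open Literature.Computability.MetaComplexity Literature.Computability.MetaComplexity.Smolensky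

/-! ## PART I «SpanDial» — wide readers cost their RANK, not their NUMBER

Part H charged every wide cut (window support `> s`) a factor `3` in the character budget, so its law needs
`#wide(s) = O(ℓ)` and its residual (the crowd piece) still contains the dense core "every cut reads the whole window
mod `p`".  Part I replaces the count by the RANK: if on each fibre the wide cuts answer through the values of `d`
linear forms of the window (`WRankLE … s d`, the wide-restricted version of g24's `RankLE`), then the product of their
signs is ONE bounded function of those `d` values, i.e. a combination of `p^d` products of affine indicators, and an
affine indicator is an AVERAGE of `p` characters — multiplying by it does not increase the twisted-sum bound at all
(§22).  Hence the SPAN LAW (§24, proved for every prime `p ≠ 3`): unlimited narrow cuts + wide cuts of fibre rank `d`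
with `(p·d + 2)·M ≤ ℓ` ⟹ `12·#WIN ≤ 11·2ⁿ`.  It contains the mixed law (`d = #wide`) and removes the dense core
(rank `1`); the residual of the high-rank piece becomes the SPREAD piece: more than `ℓ/E` wide cuts that are
LINEARLY INDEPENDENT on the window (on some fibre they do not factor through `ℓ/E` forms). -/

/-! ### §22 Functions of `d` linear forms cost `p^d` characters -/

section SpanInd
variable {p : ℕ} [Fact p.Prime] {ℓ : ℕ}

/-- The `{0,1}`-indicator (in `ℂ`) of the affine `𝔽_p`-test `[lin β (v) = z]`. -/
def indC (β : Fin ℓ → ZMod p) (z : ZMod p) (v : Fin ℓ → Bool) : ℂ := if linPart β v = z then 1 else 0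

/-- Character expansion of an affine indicator: `[lin β = z] = p⁻¹·Σ_k e_p(−kz)·e_p(k·lin β)`.
[tree: `TwoModuli.ite_eq_eq_sum_stdAddChar_one`] -/
theorem indC_eq (β : Fin ℓ → ZMod p) (z : ZMod p) (v : Fin ℓ → Bool) :
    indC β z v = ((p : ℂ))⁻¹ * ∑ k : ZMod p,
      (ZMod.stdAddChar (-(k * z)) : ℂ) * ZMod.stdAddChar (k * linPart β v) := by
  unfold indC
  exact TwoModuli.ite_eq_eq_sum_stdAddChar_one (linPart β v) z

/-- **INDICATOR CLOSURE**: multiplying a test weight `T` by indicators of affine `𝔽_p`-tests does NOT increase the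
bound `A` on its `e_p`-twisted sums (an indicator is an average of `p` characters, each of which only shifts the
twist). -/
theorem norm_sum_mul_prod_indC_le (T : (Fin ℓ → Bool) → ℂ) {A : ℝ}
    (hA : ∀ μ : Fin ℓ → ZMod p, ‖∑ v, T v * ZMod.stdAddChar (linPart μ v)‖ ≤ A)
    {ι : Type*} (K : Finset ι) (Φ : ι → Fin ℓ → ZMod p) (x : ι → ZMod p) :
    ∀ μ : Fin ℓ → ZMod p,
      ‖∑ v, T v * (∏ k ∈ K, indC (Φ k) (x k) v) * ZMod.stdAddChar (linPart μ v)‖ ≤ A := by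
  classical
  induction K using Finset.induction_on with
  | empty =>
    intro μ
    simp only [Finset.prod_empty, mul_one]
    exact hA μ
  | @insert k₀ K hk₀ ih =>
    intro μ
    have hv : ∀ v : Fin ℓ → Bool,
        T v * (∏ k ∈ insert k₀ K, indC (Φ k) (x k) v) * ZMod.stdAddChar (linPart μ v) =
          ((p : ℂ))⁻¹ * ∑ k : ZMod p, (ZMod.stdAddChar (-(k * x k₀)) : ℂ) *
            (T v * (∏ k ∈ K, indC (Φ k) (x k) v) * ZMod.stdAddChar (linPart (μ + k • Φ k₀) v)) := by
      intro v
      rw [Finset.prod_insert hk₀, indC_eq]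
      set PK := ∏ k ∈ K, indC (Φ k) (x k) v
      set S := ∑ k : ZMod p, (ZMod.stdAddChar (-(k * x k₀)) : ℂ) * ZMod.stdAddChar (k * linPart (Φ k₀) v)
      have h1 : T v * ((((p : ℂ))⁻¹ * S) * PK) * ZMod.stdAddChar (linPart μ v) =
          ((p : ℂ))⁻¹ * (S * (T v * PK * ZMod.stdAddChar (linPart μ v))) := by ring
      rw [h1, Finset.sum_mul]
      congr 1
      refine Finset.sum_congr rfl fun k _ => ?_
      rw [← stdAddChar_linPart_mul μ (Φ k₀) k v]
      ring
    rw [Finset.sum_congr rfl fun v _ => hv v, ← Finset.mul_sum, Finset.sum_comm]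
    simp_rw [← Finset.mul_sum]
    have hp0' : (p : ℝ) ≠ 0 := by exact_mod_cast (Fact.out : p.Prime).ne_zero
    rw [norm_mul, norm_inv, Complex.norm_natCast]
    calc (p : ℝ)⁻¹ * ‖∑ k : ZMod p, (ZMod.stdAddChar (-(k * x k₀)) : ℂ) *
            ∑ v, T v * (∏ k ∈ K, indC (Φ k) (x k) v) * ZMod.stdAddChar (linPart (μ + k • Φ k₀) v)‖
        ≤ (p : ℝ)⁻¹ * ∑ _k : ZMod p, A := by
          refine mul_le_mul_of_nonneg_left ?_ (by positivity)
          refine le_trans (norm_sum_le _ _) (Finset.sum_le_sum fun k _ => ?_)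
          rw [norm_mul, AddChar.norm_apply, one_mul]
          exact ih (μ + k • Φ k₀)
      _ = A := by
          rw [Finset.sum_const, Finset.card_univ, ZMod.card, nsmul_eq_mul]
          field_simp

/-- A function of the values of `d` linear forms is a combination of the `p^d` products of their indicators. -/
theorem comp_eq_sum_prod_indC {ι : Type*} [Fintype ι] [DecidableEq ι] (Φ : ι → Fin ℓ → ZMod p)
    (F : (ι → ZMod p) → ℂ) (v : Fin ℓ → Bool) :
    F (fun k => linPart (Φ k) v) = ∑ x : ι → ZMod p, F x * ∏ k, indC (Φ k) (x k) v := by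
  have hprod : ∀ x : ι → ZMod p,
      (∏ k, indC (Φ k) (x k) v) = if (fun k => linPart (Φ k) v) = x then 1 else 0 := by
    intro x
    simp only [indC, Fintype.prod_boole, funext_iff]
  simp_rw [hprod, mul_ite, mul_one, mul_zero]
  rw [Finset.sum_ite_eq]
  simp

/-- **COMPOSITION BOUND**: multiplying `T` by a bounded function of the values of `d` linear forms costs at most a
factor `p^d` in the twisted-sum bound. -/
theorem norm_sum_mul_comp_le (T : (Fin ℓ → Bool) → ℂ) {A : ℝ}
    (hA : ∀ μ : Fin ℓ → ZMod p, ‖∑ v, T v * ZMod.stdAddChar (linPart μ v)‖ ≤ A)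
    {ι : Type*} [Fintype ι] [DecidableEq ι] (Φ : ι → Fin ℓ → ZMod p) (F : (ι → ZMod p) → ℂ)
    (hF : ∀ x, ‖F x‖ ≤ 1) :
    ∀ μ : Fin ℓ → ZMod p,
      ‖∑ v, T v * F (fun k => linPart (Φ k) v) * ZMod.stdAddChar (linPart μ v)‖ ≤
        (p : ℝ) ^ Fintype.card ι * A := by
  intro μ
  have hv : ∀ v : Fin ℓ → Bool, T v * F (fun k => linPart (Φ k) v) * ZMod.stdAddChar (linPart μ v) =
      ∑ x : ι → ZMod p, F x * (T v * (∏ k, indC (Φ k) (x k) v) * ZMod.stdAddChar (linPart μ v)) := by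
    intro v
    rw [comp_eq_sum_prod_indC Φ F v, Finset.mul_sum, Finset.sum_mul]
    refine Finset.sum_congr rfl fun x _ => ?_
    ring
  rw [Finset.sum_congr rfl fun v _ => hv v, Finset.sum_comm]
  simp_rw [← Finset.mul_sum]
  calc ‖∑ x : ι → ZMod p, F x * ∑ v, T v * (∏ k, indC (Φ k) (x k) v) * ZMod.stdAddChar (linPart μ v)‖
      ≤ ∑ x : ι → ZMod p, ‖F x * ∑ v, T v * (∏ k, indC (Φ k) (x k) v) * ZMod.stdAddChar (linPart μ v)‖ :=
        norm_sum_le _ _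
    _ ≤ ∑ _x : ι → ZMod p, A := Finset.sum_le_sum fun x _ => by
        rw [norm_mul]
        calc ‖F x‖ * ‖∑ v, T v * (∏ k, indC (Φ k) (x k) v) * ZMod.stdAddChar (linPart μ v)‖
            ≤ 1 * A := mul_le_mul (hF x) (norm_sum_mul_prod_indC_le T hA Finset.univ Φ x μ)
              (norm_nonneg _) zero_le_one
          _ = A := one_mul A
    _ = (p : ℝ) ^ Fintype.card ι * A := by
        rw [Finset.sum_const, Finset.card_univ, Fintype.card_fun, ZMod.card, nsmul_eq_mul]
        push_cast
        ring

end SpanInd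

end Summit.QuantumAdvantage.QuantumAdvantage.Theorems.RankDial

end
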